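import Literature.NumberTheory.Automorphic.SLTwoTreeProjectiveAction            -- ★ B-p08 (g28) (W1c)-A: `glVertexAct`, `glVertexAct_eq_iff`, rigidity ∕ existence
import HarnessLib

/-!
# The vertex action of `GL₂(F)` on the tree of `SL₂(F)`: determinant-one elements, type parity, adjacency (Serre, *Trees* II.1.2–1.3)

Topic `NumberTheory/Automorphic`; namespace `Literature.NumberTheory.Automorphic.HermitianLatticeTree`.  THEOREMS ONLY (no definition, no instance, no notation, no named
fact, no `sorry`); kernel lane.  ROAD W («R2EP-wild») brick (W1c)-A part 2 (seat B-p08 (g28); B-p14 (g32) 10:23:49Z; LEAD F0P3a-plan (g10) T9-18 (3)).  HONEST LABEL: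
HC_CM is proved only modulo the cell's remaining named inputs (hLiu418, h413) until rung 0 closes; nothing printed is asserted here.

* `glVertexAct_coe_of_valuation_det_eq_one` — `|det g| = 1` ⇒ `g · M = g M` (no rescaling; e.g. `g ∈ SL₂(F)`), and the TYPE is preserved
  (`isSelfDualLattice_glVertexAct_iff_of_valuation_det_eq_one`);
* `glVertexAct_coe_of_valuation_det_eq_of_isSelfDual` ∕ `…_of_isModular` — `|det g| = |ϖ|`: a self-dual `M` goes to the MODULAR `g M`, a modular `M` to the
  SELF-DUAL `ϖ⁻¹ g M` (the TYPES SWAP: an element of odd determinant valuation exchanges the two vertex classes — the inversions of ROAD W);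
* **`latticeTree_adj_glVertexAct_of_valuation_det_eq_one`**, **`latticeTree_adj_glVertexAct_of_valuation_det_eq`** — adjacency is preserved in both cases.
[cite: Serre1980Trees, Ch. II §1.2–§1.3] [cite: Kottwitz1988, §2]
-/

set_option autoImplicit false

noncomputable section

open scoped ValuativeRel Matrix MatrixGroups
open Matrix ValuativeRel

namespace Literature.NumberTheory.Automorphic.HermitianLatticeTree

variable {F : Type*} [Field F] [ValuativeRel F] {ϖ : F} (hϖ : IsUniformizingElement ϖ) [IsDiscreteValuationRing 𝒪[F]]

omit [IsDiscreteValuationRing 𝒪[F]] in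
/-- `|det (g h)|` for `|det g| = |c|`: `|det (g h)| = |c| · |det h|`. [cite: Serre1980Trees, Ch. II §1.2] -/
theorem valuation_det_coe_mul (g h : GL (Fin 2) F) :
    valuation F ((g * h : GL (Fin 2) F) : Matrix (Fin 2) (Fin 2) F).det = valuation F (g : Matrix (Fin 2) (Fin 2) F).det * valuation F (h : Matrix (Fin 2) (Fin 2) F).det := by
  rw [Units.val_mul, Matrix.det_mul, map_mul]

include hϖ in
/-- **DETERMINANT-ONE ELEMENTS DO NOT RESCALE**: if `|det g| = 1` then `(g · M) = g M` as lattices, and `g M` has the same type as `M`.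
[cite: Serre1980Trees, Ch. II §1.2] -/
theorem glVertexAct_coe_of_valuation_det_eq_one {g : GL (Fin 2) F} (hg : valuation F (g : Matrix (Fin 2) (Fin 2) F).det = 1)
    (M : {M : Submodule 𝒪[F] (Fin 2 → F) // IsSpecialLattice (RingHom.id F) ϖ !![(0 : F), 1; -1, 0] M}) :
    (glVertexAct hϖ g M).1 = mapGL g M.1 := by
  have h0 := hϖ.ne_zero
  obtain ⟨h, e, he, hM, hdet⟩ := exists_latt_eq_of_isSpecialLattice h0 M.2
  have hspec : IsSpecialLattice (RingHom.id F) ϖ !![(0 : F), 1; -1, 0] (mapGL g M.1) := by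
    rw [hM, mapGL_latt]
    exact isSpecialLattice_latt_of_valuation_det h0 _ he (by rw [valuation_det_coe_mul, hg, one_mul, hdet])
  have h := (glVertexAct_eq_iff hϖ g M ⟨mapGL g M.1, hspec⟩).2 ⟨0, by rw [zpow_zero, scaleLattice_one]⟩
  exact congrArg Subtype.val h

omit [IsDiscreteValuationRing 𝒪[F]] in
/-- `|det g| = 1`: `g` maps self-dual lattices to self-dual lattices. [cite: Serre1980Trees, Ch. II §1.2] -/
theorem isSelfDualLattice_mapGL_of_valuation_det_eq_one {g : GL (Fin 2) F} (hg : valuation F (g : Matrix (Fin 2) (Fin 2) F).det = 1)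
    {M : Submodule 𝒪[F] (Fin 2 → F)} (hM : IsSelfDualLattice (RingHom.id F) !![(0 : F), 1; -1, 0] M) :
    IsSelfDualLattice (RingHom.id F) !![(0 : F), 1; -1, 0] (mapGL g M) := by
  obtain ⟨h, rfl, hdet⟩ := (isSelfDualLattice_id_altJ_iff M).1 hM
  rw [mapGL_latt]
  exact (isSelfDualLattice_id_altJ_iff _).2 ⟨g * h, rfl, by rw [valuation_det_coe_mul, hg, one_mul, hdet]⟩

omit [IsDiscreteValuationRing 𝒪[F]] in
/-- `|det g| = 1`: `g` maps `ϖ`-modular lattices to `ϖ`-modular lattices. [cite: Serre1980Trees, Ch. II §1.2] -/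
theorem isModularLattice_mapGL_of_valuation_det_eq_one (h0 : ϖ ≠ 0) {g : GL (Fin 2) F} (hg : valuation F (g : Matrix (Fin 2) (Fin 2) F).det = 1)
    {M : Submodule 𝒪[F] (Fin 2 → F)} (hM : IsModularLattice (RingHom.id F) ϖ !![(0 : F), 1; -1, 0] M) :
    IsModularLattice (RingHom.id F) ϖ !![(0 : F), 1; -1, 0] (mapGL g M) := by
  obtain ⟨h, rfl, hdet⟩ := (isModularLattice_id_altJ_iff h0 M).1 hM
  rw [mapGL_latt]
  exact (isModularLattice_id_altJ_iff h0 _).2 ⟨g * h, rfl, by rw [valuation_det_coe_mul, hg, one_mul, hdet]⟩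

omit [IsDiscreteValuationRing 𝒪[F]] in
/-- **`|det g| = |ϖ|` SWAPS THE TYPES, I**: a self-dual `M` is mapped to the `ϖ`-MODULAR lattice `g M`. [cite: Serre1980Trees, Ch. II §1.2–§1.3] -/
theorem isModularLattice_mapGL_of_valuation_det_eq (h0 : ϖ ≠ 0) {g : GL (Fin 2) F} (hg : valuation F (g : Matrix (Fin 2) (Fin 2) F).det = valuation F ϖ)
    {M : Submodule 𝒪[F] (Fin 2 → F)} (hM : IsSelfDualLattice (RingHom.id F) !![(0 : F), 1; -1, 0] M) :
    IsModularLattice (RingHom.id F) ϖ !![(0 : F), 1; -1, 0] (mapGL g M) := by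
  obtain ⟨h, rfl, hdet⟩ := (isSelfDualLattice_id_altJ_iff M).1 hM
  rw [mapGL_latt]
  exact (isModularLattice_id_altJ_iff h0 _).2 ⟨g * h, rfl, by rw [valuation_det_coe_mul, hg, hdet, mul_one]⟩

omit [IsDiscreteValuationRing 𝒪[F]] in
/-- **`|det g| = |ϖ|` SWAPS THE TYPES, II**: a `ϖ`-modular `M` is mapped to `g M = ϖ · (SELF-DUAL lattice)`, namely `ϖ⁻¹ · g M` is self-dual.
[cite: Serre1980Trees, Ch. II §1.2–§1.3] -/
theorem isSelfDualLattice_scaleLattice_inv_mapGL_of_valuation_det_eq (h0 : ϖ ≠ 0) {g : GL (Fin 2) F} (hg : valuation F (g : Matrix (Fin 2) (Fin 2) F).det = valuation F ϖ)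
    {M : Submodule 𝒪[F] (Fin 2 → F)} (hM : IsModularLattice (RingHom.id F) ϖ !![(0 : F), 1; -1, 0] M) :
    IsSelfDualLattice (RingHom.id F) !![(0 : F), 1; -1, 0] (scaleLattice ϖ⁻¹ (mapGL g M)) := by
  obtain ⟨h, rfl, hdet⟩ := (isModularLattice_id_altJ_iff h0 M).1 hM
  rw [mapGL_latt, scaleLattice_latt]
  have hdet' : (ϖ⁻¹ • ((g * h : GL (Fin 2) F) : Matrix (Fin 2) (Fin 2) F)).det ≠ 0 := by
    rw [Matrix.det_smul, Fintype.card_fin]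
    exact mul_ne_zero (pow_ne_zero _ (inv_ne_zero h0)) ((g * h).isUnit.map Matrix.detMonoidHom).ne_zero
  refine (isSelfDualLattice_id_altJ_iff _).2 ⟨Matrix.GeneralLinearGroup.mk'' _ (isUnit_iff_ne_zero.2 hdet'), rfl, ?_⟩
  show valuation F (ϖ⁻¹ • ((g * h : GL (Fin 2) F) : Matrix (Fin 2) (Fin 2) F)).det = 1
  have hv0 : valuation F ϖ ≠ 0 := (Valuation.ne_zero_iff _).2 h0
  rw [valuation_det_smul, valuation_det_coe_mul, hg, hdet, map_inv₀]
  field_simp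

include hϖ in
/-- `|det g| = |ϖ|`, `M` self-dual: `g · M = g M` (already `ϖ`-modular, no rescaling). [cite: Serre1980Trees, Ch. II §1.2–§1.3] -/
theorem glVertexAct_coe_of_valuation_det_eq_of_isSelfDual {g : GL (Fin 2) F} (hg : valuation F (g : Matrix (Fin 2) (Fin 2) F).det = valuation F ϖ)
    (M : {M : Submodule 𝒪[F] (Fin 2 → F) // IsSpecialLattice (RingHom.id F) ϖ !![(0 : F), 1; -1, 0] M}) (hM : IsSelfDualLattice (RingHom.id F) !![(0 : F), 1; -1, 0] M.1) :
    (glVertexAct hϖ g M).1 = mapGL g M.1 := by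
  have hspec : IsSpecialLattice (RingHom.id F) ϖ !![(0 : F), 1; -1, 0] (mapGL g M.1) := Or.inr (isModularLattice_mapGL_of_valuation_det_eq hϖ.ne_zero hg hM)
  exact congrArg Subtype.val ((glVertexAct_eq_iff hϖ g M ⟨mapGL g M.1, hspec⟩).2 ⟨0, by rw [zpow_zero, scaleLattice_one]⟩)

include hϖ in
/-- `|det g| = |ϖ|`, `M` modular: `g · M = ϖ⁻¹ · g M` (the self-dual representative). [cite: Serre1980Trees, Ch. II §1.2–§1.3] -/
theorem glVertexAct_coe_of_valuation_det_eq_of_isModular {g : GL (Fin 2) F} (hg : valuation F (g : Matrix (Fin 2) (Fin 2) F).det = valuation F ϖ)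
    (M : {M : Submodule 𝒪[F] (Fin 2 → F) // IsSpecialLattice (RingHom.id F) ϖ !![(0 : F), 1; -1, 0] M}) (hM : IsModularLattice (RingHom.id F) ϖ !![(0 : F), 1; -1, 0] M.1) :
    (glVertexAct hϖ g M).1 = scaleLattice ϖ⁻¹ (mapGL g M.1) := by
  have hspec : IsSpecialLattice (RingHom.id F) ϖ !![(0 : F), 1; -1, 0] (scaleLattice ϖ⁻¹ (mapGL g M.1)) :=
    Or.inl (isSelfDualLattice_scaleLattice_inv_mapGL_of_valuation_det_eq hϖ.ne_zero hg hM)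
  exact congrArg Subtype.val ((glVertexAct_eq_iff hϖ g M ⟨_, hspec⟩).2 ⟨-1, by rw [_root_.zpow_neg, zpow_one]⟩)

include hϖ in
/-- **ADJACENCY IS PRESERVED by determinant-one elements** (types kept, inclusions transported by `mapGL`). [cite: Serre1980Trees, Ch. II §1.2] -/
theorem latticeTree_adj_glVertexAct_of_valuation_det_eq_one {g : GL (Fin 2) F} (hg : valuation F (g : Matrix (Fin 2) (Fin 2) F).det = 1)
    {M N : {M : Submodule 𝒪[F] (Fin 2 → F) // IsSpecialLattice (RingHom.id F) ϖ !![(0 : F), 1; -1, 0] M}} (hMN : (latticeTree (RingHom.id F) ϖ !![(0 : F), 1; -1, 0]).Adj M N) :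
    (latticeTree (RingHom.id F) ϖ !![(0 : F), 1; -1, 0]).Adj (glVertexAct hϖ g M) (glVertexAct hϖ g N) := by
  have h0 := hϖ.ne_zero
  rw [latticeTree_adj_iff] at hMN ⊢
  obtain ⟨hne, hcases⟩ := hMN
  refine ⟨fun heq => hne ?_, ?_⟩
  · -- injectivity: `g⁻¹ · (g · M) = M`
    have h1 := congrArg (glVertexAct hϖ g⁻¹) heq
    rwa [← glVertexAct_mul, ← glVertexAct_mul, inv_mul_cancel, glVertexAct_one, glVertexAct_one] at h1
  · rw [glVertexAct_coe_of_valuation_det_eq_one hϖ hg, glVertexAct_coe_of_valuation_det_eq_one hϖ hg]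
    rcases hcases with ⟨hM, hN, h1, h2⟩ | ⟨hN, hM, h1, h2⟩
    · exact Or.inl ⟨isSelfDualLattice_mapGL_of_valuation_det_eq_one hg hM, isModularLattice_mapGL_of_valuation_det_eq_one h0 hg hN,
        by rw [← mapGL_scaleLattice]; exact (mapGL_le_mapGL_iff _ _ _).2 h1, (mapGL_le_mapGL_iff _ _ _).2 h2⟩
    · exact Or.inr ⟨isSelfDualLattice_mapGL_of_valuation_det_eq_one hg hN, isModularLattice_mapGL_of_valuation_det_eq_one h0 hg hM,
        by rw [← mapGL_scaleLattice]; exact (mapGL_le_mapGL_iff _ _ _).2 h1, (mapGL_le_mapGL_iff _ _ _).2 h2⟩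

include hϖ in
/-- **ADJACENCY IS PRESERVED by elements of determinant valuation `|ϖ|`** (the two ends swap types: self-dual `M ↦ gM` modular, modular `N ↦ ϖ⁻¹gN` self-dual,
and `ϖM ≤ N ≤ M` becomes `ϖ(ϖ⁻¹gN) ≤ gM ≤ ϖ⁻¹gN`). [cite: Serre1980Trees, Ch. II §1.2–§1.3] -/
theorem latticeTree_adj_glVertexAct_of_valuation_det_eq {g : GL (Fin 2) F} (hg : valuation F (g : Matrix (Fin 2) (Fin 2) F).det = valuation F ϖ)
    {M N : {M : Submodule 𝒪[F] (Fin 2 → F) // IsSpecialLattice (RingHom.id F) ϖ !![(0 : F), 1; -1, 0] M}} (hMN : (latticeTree (RingHom.id F) ϖ !![(0 : F), 1; -1, 0]).Adj M N) :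
    (latticeTree (RingHom.id F) ϖ !![(0 : F), 1; -1, 0]).Adj (glVertexAct hϖ g M) (glVertexAct hϖ g N) := by
  have h0 := hϖ.ne_zero
  rw [latticeTree_adj_iff] at hMN ⊢
  obtain ⟨hne, hcases⟩ := hMN
  refine ⟨fun heq => hne ?_, ?_⟩
  · have h1 := congrArg (glVertexAct hϖ g⁻¹) heq
    rwa [← glVertexAct_mul, ← glVertexAct_mul, inv_mul_cancel, glVertexAct_one, glVertexAct_one] at h1
  · -- the scaling identities `ϖ · (ϖ⁻¹ · L) = L`
    have hsc : ∀ L : Submodule 𝒪[F] (Fin 2 → F), scaleLattice ϖ (scaleLattice ϖ⁻¹ L) = L := fun L => by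
      rw [scaleLattice_scaleLattice, mul_inv_cancel₀ h0, scaleLattice_one]
    rcases hcases with ⟨hM, hN, h1, h2⟩ | ⟨hN, hM, h1, h2⟩
    · -- `M` self-dual, `N` modular: images `gM` (modular), `ϖ⁻¹gN` (self-dual); adjacency in the swapped order
      rw [glVertexAct_coe_of_valuation_det_eq_of_isSelfDual hϖ hg M hM, glVertexAct_coe_of_valuation_det_eq_of_isModular hϖ hg N hN]
      refine Or.inr ⟨isSelfDualLattice_scaleLattice_inv_mapGL_of_valuation_det_eq h0 hg hN, isModularLattice_mapGL_of_valuation_det_eq h0 hg hM, ?_, ?_⟩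
      · rw [hsc]; exact (mapGL_le_mapGL_iff _ _ _).2 h2
      · rw [← scaleLattice_le_scaleLattice_iff h0, hsc, ← mapGL_scaleLattice]; exact (mapGL_le_mapGL_iff _ _ _).2 h1
    · rw [glVertexAct_coe_of_valuation_det_eq_of_isModular hϖ hg M hM, glVertexAct_coe_of_valuation_det_eq_of_isSelfDual hϖ hg N hN]
      refine Or.inl ⟨isSelfDualLattice_scaleLattice_inv_mapGL_of_valuation_det_eq h0 hg hM, isModularLattice_mapGL_of_valuation_det_eq h0 hg hN, ?_, ?_⟩
      · rw [hsc]; exact (mapGL_le_mapGL_iff _ _ _).2 h2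
      · rw [← scaleLattice_le_scaleLattice_iff h0, hsc, ← mapGL_scaleLattice]; exact (mapGL_le_mapGL_iff _ _ _).2 h1

end Literature.NumberTheory.Automorphic.HermitianLatticeTree

end
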